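import Literature.MathematicalPhysics.QuantumFieldTheory.Balaban1983to89.Node00.Record13CoPHChi
import Summits.QuantumFields.YangMills.Theorems.BalabanUVNodesN11BackgroundScaleLocal

/-!
# DAG node N11 — χ-GENERIC RE-ISSUE (WORK ORDER RC-1 «RE-CENTRE THE RECORD», director-ym №462 (B) ∕ №467 (D)) of `…N11BackgroundScaleLocal`'s ONE
# centre-typed theorem: (BL) scale-locality of node00-def-T's background of record `UbgOfRecord₁₃CoPChi θ χ p n s 𝐖` at EVERY level, in the β-slot `χ`

Cell `pub-ymgap`, YM-PLAN Track A (HUMAN RULING D-0062), seat `pub-ymgap-dag-n11-d` (g44; N11 [B14] s2), helper lane of K1⁹ (count-neutral).  PILOT module of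
the N11-σ census (`N11-G44-RC1-REACH-CENSUS.md`): the module `…N11BackgroundScaleLocal` has exactly one centre-typed declaration,
`UbgOfRecord₁₃CoP_congr_of_agree_le` (typed over `gOfRecord₁₃` ∕ `UbgOfRecord₁₃CoP`, which read the (2.9) centre through `betaOfRecord₁₃ → chiβOfRecord₁₃`);
its seven other declarations are centre-FREE and are reused BY NAME.  This file re-issues that one theorem VERBATIM over [Ax-3c]'s χ-generic carriers
`gOfRecord₁₃Chi θ χ` ∕ `UbgOfRecord₁₃CoPChi θ χ` (`Node00/Record13CoPHChi`, porter PT-A-2 ∕ custodians node00 def-Y∕def-T∕K0e): σ = (`gOfRecord₁₃ F N θ p ↦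
gOfRecord₁₃Chi F N θ χ p`, `UbgOfRecord₁₃CoP F N θ p ↦ UbgOfRecord₁₃CoPChi F N θ χ p`, row lemmas `↦ …_chi`); same short name in the sibling namespace
`…N11BackgroundScaleLocalChi` (consumers switch by namespace).  At `χ := chiβOfRecord₁₃ θ` it is the landed theorem (definitionally, [Ax-3c]'s `rfl` receipts);
at `χ := chiβOfRecord₁₃Ax θ` it is the statement the Ax-record's N11 machine reads.  Nothing of record edited (body-freeze №460 (2)).

HONEST FRAMING.  Kernel bookkeeping on the tree's typing of (2.12), χ-generic; nothing of Bałaban asserted ([15] Thm 1 NOT used); N11 NOT discharged; K-items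
untouched; counts unmoved.  One finite `𝕋⁴_{L^K}` programme at fixed `ε = L^{−K}` — NOT ℝ⁴, NOT OS, NOT a mass gap, NOT Clay.  No `sorry`∕`def`∕`instance`∕`notation`.
Sources (bookkeeping only): [III] = [Balaban1988Convergent] (2.2) p.255, (2.12)–(2.13) pp.256–257, §2 p.258; [I] = [Balaban1987RG1] (2.9) p.266 (the cut-off's centre).
-/

noncomputable section

namespace Summit.QuantumFields.YangMills.Theorems.BalabanUVNodesN11BackgroundScaleLocalChi

open Literature.MathematicalPhysics.QuantumFieldTheory.Balaban1983to89 T4Continuum Node00 Node00.Tk DagBinding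
open B15DeterminingSets B15DeterminingSetsB
open Summit.QuantumFields.YangMills.Theorems.BalabanUVNodesN11BackgroundScaleLocal (UbgMSCoPOfRecord_congr_of_agree_le UbgMSCoPOfRecordB_congr_of_agree_le)

variable {F : T4Family} {N : ℕ} [NeZero N]

/-- **★ (BL) FOR node00-def-T's BACKGROUND OF RECORD AT EVERY LEVEL, χ-GENERIC**: `UbgOfRecord₁₃CoPChi θ χ p n s 𝐖` reads `𝐖` at the scales `≤ n` only
(level `0`: the fine field `𝐖 0`; level `n+1`: def-R's print-datum background of record) — the verbatim re-issue of
`…N11BackgroundScaleLocal.UbgOfRecord₁₃CoP_congr_of_agree_le` in the β-slot `χ` (RC-1). [cite: Balaban1988Convergent, (2.12)–(2.13) pp.256–257, §2 p.258; Balaban1987RG1, (2.9) p.266 (bookkeeping)] -/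
theorem UbgOfRecord₁₃CoP_congr_of_agree_le (θ : Stage13Params F N) (χ : ChiSlot F N) (p : B12.RunParams) :
    ∀ (n : ℕ) (s : SeqOfRecord F θ.ν θ.τ9.M (gOfRecord₁₃Chi F N θ χ p) p.K n) {W W' : MSField (F.P p.K) (SU N)},
      (∀ i, i ≤ n → W i = W' i) → UbgOfRecord₁₃CoPChi F N θ χ p n s W = UbgOfRecord₁₃CoPChi F N θ χ p n s W'
  | 0, s, W, W', h => by
      rw [UbgOfRecord₁₃CoP_zero_chi]
      exact h 0 le_rfl
  | n + 1, s, W, W', h => by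
      rw [UbgOfRecord₁₃CoP_succ_chi]
      exact UbgMSCoPOfRecordB_congr_of_agree_le _ _ _ _ _ s h

end Summit.QuantumFields.YangMills.Theorems.BalabanUVNodesN11BackgroundScaleLocalChi

end
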